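import Literature.Probability.LatticeModels.CriticalScalingDimension
import Literature.Probability.LatticeModels.PointwiseScalingLimitEtaExists

/-!
# Short distances do not dominate the box two-point sum: `χ(ηL) ≤ ε χ(L/2)` at `β_c` on `ℤ³`

Route `LeeYangGap` (Ising3DConformalLimit), support item `GaussianLimitKillsBlockCoupling`
(stmt-CriticalPhenomena-4950), helper file 2/3. Notation: `G(z) = ⟨σ₀σ_z⟩_{β_c} = criticalTwoPoint 3 z`,
`χ(m) = Σ_{z ∈ Λ_m} G(z)`, `A_j = G(2^j e₁)` (all written out, no definitions).

Setting: a pointwise scaling limit `S` of `criticalCorr 3` with renormalisation `ρ > 0` on `(0,1]`,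
non-degenerate two-point function and scale covariance of dimension `Δ`. Then:

* `exists_axis_doubling` — **dyadic doubling of the axis two-point function**: `A_j ≤ 5 A_{j+1}` for
  all large `j`. Indeed `ρ(δ_k)² A_{k+1} → S₂(0,e) > 0` and `ρ(δ_k)² A_{k+2} → S₂(0,2e) = 2^{-2Δ} S₂(0,e)`
  along `δ_k = 2^{-(k+1)}` (`tendsto_rescaled_dyadic`, `S_two_unitVec_eq`), and `2^{-2Δ} ≥ 1/4 > 1/5`
  because `Δ ≤ 1` (`scalingDimension_mem_Icc_holds`, from the Simon–Lieb lower bound).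
* `shell_le`, `le_shell` — the dyadic shells `χ(2^{k+1}) - χ(2^k)` are squeezed between `56·8^k A_{k+3}`
  and `512·8^k A_k` (Messager–Miracle-Solé sphere sandwich `G(3‖z‖e₁) ≤ G(z) ≤ G(‖z‖e₁)`,
  `criticalTwoPoint_axis_sandwich`, and axis antitonicity `criticalTwoPoint_axis_antitone`).
* `boxSum_two_pow_le` — hence `W_k = 8^k A_k` grows at least like `(8/5)^k`, the partial sums of the
  shells are geometric, and `χ(2^p) ≤ ε χ(2^{q+1})` once `q - p` and `q` are large.
* `exists_eta_boxSum_floor_le` — **for every `ε > 0` there is `η ∈ (0,1]` with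
  `χ(⌊ηL⌋) ≤ ε χ(L/2)` for all large `L`** (`Nat.log 2` bookkeeping).

This is the a-priori "no concentration at short distances" estimate (a discrete Potter bound of index
`log₂ 5 < 3`) needed to control the near-coincident part of the block Binder cumulant.

## References

* A. Messager, S. Miracle-Solé, J. Stat. Phys. 17 (1977) 245–262 [MessagerMiracleSoleJSP1977].
* H. Duminil-Copin, *Lectures on the Ising and Potts models* (2019), Thm. 4.8 and eq. (4.10)
  [DuminilCopin2019].
-/

noncomputable section

namespace Summit.CriticalPhenomena.Ising3DConformalLimit.LeeYangGapGaussianLimitKillsBlockCoupling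

open Literature.Probability.LatticeModels Filter Set Finset
open scoped Topology BigOperators

/-! ### Dyadic doubling of the axis two-point function from the scaling limit -/

/-- **Dyadic doubling of `⟨σ₀σ_{2^j e₁}⟩_{β_c}` on `ℤ³`.** If `criticalCorr 3` has a pointwise scaling
limit `S` with renormalisation `ρ > 0` on `(0,1]`, non-degenerate two-point function and scale covariance
of dimension `Δ`, then `⟨σ₀σ_{2^j e₁}⟩_{β_c} ≤ 5 ⟨σ₀σ_{2^{j+1} e₁}⟩_{β_c}` for all large `j`
(`ρ(δ_k)²⟨σ₀σ_{2^{k+1}e₁}⟩ → S₂(0,e) > 0`, `ρ(δ_k)²⟨σ₀σ_{2^{k+2}e₁}⟩ → 2^{-2Δ}S₂(0,e)` and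
`2^{-2Δ} ≥ 1/4` since `Δ ≤ 1`, `scalingDimension_mem_Icc_holds`). [cite: DuminilCopin2019, Thm. 4.8, §4.4] -/
theorem exists_axis_doubling {ρ : ℝ → ℝ} {Δ : ℝ} {S : CorrFamily 3}
    (hρ : ∀ δ ∈ Set.Ioc (0:ℝ) 1, 0 < ρ δ)
    (hlim : HasPointwiseScalingLimit (criticalCorr 3) ρ S) (hnd : IsNondegenerateTwoPoint S)
    (hsc : IsScaleCovariant Δ S) :
    ∃ j₀ : ℕ, ∀ j, j₀ ≤ j →
      criticalTwoPoint 3 (Pi.single 0 ((2 ^ j : ℕ) : ℤ)) ≤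
        5 * criticalTwoPoint 3 (Pi.single 0 ((2 ^ (j + 1) : ℕ) : ℤ)) := by
  have hΔ : Δ ≤ 1 := (scalingDimension_mem_Icc_holds ρ Δ S hlim hsc hnd hρ).2
  have hs₁pos : 0 < S 2 ![0, EuclideanSpace.single (0 : Fin 3) ((1 : ℕ) : ℝ)] :=
    hnd _ (zero_unitVec_mem_nonCoincident (by norm_num))
  have h1 := tendsto_rescaled_dyadic hlim (t := 1) one_ne_zero
  have h2 := tendsto_rescaled_dyadic hlim (t := 2) two_ne_zero
  rw [S_two_unitVec_eq hsc] at h2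
  obtain ⟨s₁, hs₁⟩ : ∃ s₁ : ℝ, S 2 ![0, EuclideanSpace.single (0 : Fin 3) ((1 : ℕ) : ℝ)] = s₁ :=
    ⟨_, rfl⟩
  rw [hs₁] at hs₁pos h1 h2
  -- `2^{-2Δ} ≥ 1/4`
  have hc : (1 / 4 : ℝ) ≤ (2 : ℝ) ^ (-(2 : ℝ) * Δ) := by
    have h : (2 : ℝ) ^ (-(2 : ℝ)) ≤ (2 : ℝ) ^ (-(2 : ℝ) * Δ) :=
      Real.rpow_le_rpow_of_exponent_le (by norm_num) (by nlinarith)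
    have h4 : (2 : ℝ) ^ (-(2 : ℝ)) = 1 / 4 := by
      rw [Real.rpow_neg (by norm_num), Real.rpow_two]; norm_num
    rw [h4] at h
    exact h
  have hlim2 : 9 / 40 * s₁ < (2 : ℝ) ^ (-(2 : ℝ) * Δ) * s₁ := by nlinarith
  have hev1 : ∀ᶠ k : ℕ in atTop, ρ ((2 : ℝ)⁻¹ ^ (k + 1)) ^ 2 *
      criticalTwoPoint 3 (Pi.single 0 (((1 : ℕ) : ℤ) * 2 ^ (k + 1))) < 9 / 8 * s₁ :=
    h1.eventually_lt_const (by linarith)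
  have hev2 : ∀ᶠ k : ℕ in atTop, 9 / 40 * s₁ < ρ ((2 : ℝ)⁻¹ ^ (k + 1)) ^ 2 *
      criticalTwoPoint 3 (Pi.single 0 (((2 : ℕ) : ℤ) * 2 ^ (k + 1))) :=
    h2.eventually_const_lt hlim2
  obtain ⟨K, hK⟩ := (hev1.and hev2).exists_forall_of_atTop
  refine ⟨K + 1, fun j hj => ?_⟩
  obtain ⟨k, rfl⟩ : ∃ k, j = k + 1 := ⟨j - 1, by omega⟩
  obtain ⟨hlt1, hlt2⟩ := hK k (by omega)
  have e1 : (((1 : ℕ) : ℤ) * 2 ^ (k + 1)) = ((2 ^ (k + 1) : ℕ) : ℤ) := by push_cast; ring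
  have e2 : (((2 : ℕ) : ℤ) * 2 ^ (k + 1)) = ((2 ^ (k + 1 + 1) : ℕ) : ℤ) := by push_cast; ring
  rw [e1] at hlt1
  rw [e2] at hlt2
  have hρpos : 0 < ρ ((2 : ℝ)⁻¹ ^ (k + 1)) ^ 2 :=
    pow_pos (hρ _ ⟨dyadicMesh_pos k, dyadicMesh_le_one k⟩) 2
  have h : ρ ((2 : ℝ)⁻¹ ^ (k + 1)) ^ 2 * criticalTwoPoint 3 (Pi.single 0 ((2 ^ (k + 1) : ℕ) : ℤ)) <
      ρ ((2 : ℝ)⁻¹ ^ (k + 1)) ^ 2 *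
        (5 * criticalTwoPoint 3 (Pi.single 0 ((2 ^ (k + 1 + 1) : ℕ) : ℤ))) := by linarith
  exact (lt_of_mul_lt_mul_left h hρpos.le).le

/-! ### The dyadic shells of `χ` -/

/-- **Upper shell bound**: `χ(2^{k+1}) - χ(2^k) ≤ 512·8^k ⟨σ₀σ_{2^k e₁}⟩_{β_c}` (on the shell
`2^k < ‖z‖_∞ ≤ 2^{k+1}`, `⟨σ₀σ_z⟩ ≤ ⟨σ₀σ_{‖z‖e₁}⟩ ≤ ⟨σ₀σ_{2^k e₁}⟩` by the MMS sandwich and axis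
antitonicity; the shell has at most `|Λ_{2^{k+1}}| ≤ 512·8^k` sites). [cite: DuminilCopin2019, Exercise 37 (4), eq. (4.10), §4.3] -/
theorem shell_le (k : ℕ) :
    ∑ z ∈ box 3 (2 ^ (k + 1)), criticalTwoPoint 3 z - ∑ z ∈ box 3 (2 ^ k), criticalTwoPoint 3 z ≤
      512 * 8 ^ k * criticalTwoPoint 3 (Pi.single 0 ((2 ^ k : ℕ) : ℤ)) := by
  classical
  have hsub : box 3 (2 ^ k) ⊆ box 3 (2 ^ (k + 1)) :=
    box_mono 3 (Nat.pow_le_pow_right two_pos (Nat.le_succ k))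
  rw [← Finset.sum_sdiff_eq_sub hsub]
  have hpt : ∀ z ∈ box 3 (2 ^ (k + 1)) \ box 3 (2 ^ k),
      criticalTwoPoint 3 z ≤ criticalTwoPoint 3 (Pi.single 0 ((2 ^ k : ℕ) : ℤ)) := by
    intro z hz
    rw [Finset.mem_sdiff, mem_box_iff_supNorm_le, mem_box_iff_supNorm_le, not_le] at hz
    have h1 : 1 ≤ Site.supNorm z := le_trans Nat.one_le_two_pow hz.2.le
    have hsand := (criticalTwoPoint_axis_sandwich h1).2
    exact hsand.trans (criticalTwoPoint_axis_antitone hz.2.le)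
  have hcard : (#(box 3 (2 ^ (k + 1)) \ box 3 (2 ^ k)) : ℝ) ≤ 512 * 8 ^ k := by
    have h1 : #(box 3 (2 ^ (k + 1)) \ box 3 (2 ^ k)) ≤ #(box 3 (2 ^ (k + 1))) :=
      Finset.card_le_card Finset.sdiff_subset
    have h2 : #(box 3 (2 ^ (k + 1))) ≤ 512 * 8 ^ k := by
      rw [card_box]
      have hX : 1 ≤ 2 ^ k := Nat.one_le_two_pow
      have h3 : 2 * 2 ^ (k + 1) + 1 ≤ 8 * 2 ^ k := by rw [pow_succ]; omega
      calc (2 * 2 ^ (k + 1) + 1) ^ 3 ≤ (8 * 2 ^ k) ^ 3 := Nat.pow_le_pow_left h3 3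
        _ = 512 * 8 ^ k := by rw [mul_pow, ← pow_mul, pow_mul']; norm_num
    exact_mod_cast h1.trans h2
  have hA : 0 ≤ criticalTwoPoint 3 (Pi.single 0 ((2 ^ k : ℕ) : ℤ)) := criticalTwoPoint_nonneg' _
  calc ∑ z ∈ box 3 (2 ^ (k + 1)) \ box 3 (2 ^ k), criticalTwoPoint 3 z
      ≤ ∑ _z ∈ box 3 (2 ^ (k + 1)) \ box 3 (2 ^ k), criticalTwoPoint 3 (Pi.single 0 ((2 ^ k : ℕ) : ℤ)) :=
        Finset.sum_le_sum hpt
    _ = (#(box 3 (2 ^ (k + 1)) \ box 3 (2 ^ k)) : ℝ) *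
          criticalTwoPoint 3 (Pi.single 0 ((2 ^ k : ℕ) : ℤ)) := by
        rw [Finset.sum_const, nsmul_eq_mul]
    _ ≤ 512 * 8 ^ k * criticalTwoPoint 3 (Pi.single 0 ((2 ^ k : ℕ) : ℤ)) :=
        mul_le_mul_of_nonneg_right hcard hA

/-- **Lower shell bound**: `56·8^k ⟨σ₀σ_{2^{k+3} e₁}⟩_{β_c} ≤ χ(2^{k+1}) - χ(2^k)` (on the shell,
`⟨σ₀σ_z⟩ ≥ ⟨σ₀σ_{3‖z‖e₁}⟩ ≥ ⟨σ₀σ_{2^{k+3}e₁}⟩` by the MMS sandwich and axis antitonicity, and the shell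
has `(2^{k+2}+1)³ - (2^{k+1}+1)³ ≥ 56·8^k` sites). [cite: DuminilCopin2019, Exercise 37 (4), eq. (4.10), §4.3] -/
theorem le_shell (k : ℕ) :
    56 * 8 ^ k * criticalTwoPoint 3 (Pi.single 0 ((2 ^ (k + 3) : ℕ) : ℤ)) ≤
      ∑ z ∈ box 3 (2 ^ (k + 1)), criticalTwoPoint 3 z - ∑ z ∈ box 3 (2 ^ k), criticalTwoPoint 3 z := by
  classical
  have hsub : box 3 (2 ^ k) ⊆ box 3 (2 ^ (k + 1)) :=
    box_mono 3 (Nat.pow_le_pow_right two_pos (Nat.le_succ k))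
  rw [← Finset.sum_sdiff_eq_sub hsub]
  have hpt : ∀ z ∈ box 3 (2 ^ (k + 1)) \ box 3 (2 ^ k),
      criticalTwoPoint 3 (Pi.single 0 ((2 ^ (k + 3) : ℕ) : ℤ)) ≤ criticalTwoPoint 3 z := by
    intro z hz
    rw [Finset.mem_sdiff, mem_box_iff_supNorm_le, mem_box_iff_supNorm_le, not_le] at hz
    have h1 : 1 ≤ Site.supNorm z := le_trans Nat.one_le_two_pow hz.2.le
    have hsand := (criticalTwoPoint_axis_sandwich h1).1
    have h3 : 3 * Site.supNorm z ≤ 2 ^ (k + 3) := by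
      have := hz.1
      rw [pow_succ, pow_succ, pow_succ] at *
      omega
    exact (criticalTwoPoint_axis_antitone h3).trans hsand
  have hcard : (56 : ℝ) * 8 ^ k ≤ (#(box 3 (2 ^ (k + 1)) \ box 3 (2 ^ k)) : ℝ) := by
    have h1 := Finset.card_sdiff_add_card_eq_card hsub
    rw [card_box, card_box] at h1
    have h2 : (#(box 3 (2 ^ (k + 1)) \ box 3 (2 ^ k)) : ℝ) + (2 * 2 ^ k + 1 : ℝ) ^ 3 =
        (2 * 2 ^ (k + 1) + 1 : ℝ) ^ 3 := by exact_mod_cast h1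
    have hX : (0 : ℝ) ≤ 2 ^ k := by positivity
    have h8 : (8 : ℝ) ^ k = (2 ^ k) ^ 3 := by
      rw [← pow_mul, show (8 : ℝ) = 2 ^ 3 by norm_num, ← pow_mul, mul_comm]
    have h3 : (2 * 2 ^ (k + 1) + 1 : ℝ) ^ 3 - (2 * 2 ^ k + 1 : ℝ) ^ 3 =
        56 * ((2 : ℝ) ^ k) ^ 3 + 36 * ((2 : ℝ) ^ k) ^ 2 + 6 * (2 : ℝ) ^ k := by
      rw [pow_succ]; ring
    have h4 : (0 : ℝ) ≤ 36 * ((2 : ℝ) ^ k) ^ 2 + 6 * (2 : ℝ) ^ k := by positivity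
    rw [h8]
    linarith
  have hA : 0 ≤ criticalTwoPoint 3 (Pi.single 0 ((2 ^ (k + 3) : ℕ) : ℤ)) := criticalTwoPoint_nonneg' _
  calc 56 * 8 ^ k * criticalTwoPoint 3 (Pi.single 0 ((2 ^ (k + 3) : ℕ) : ℤ))
      ≤ (#(box 3 (2 ^ (k + 1)) \ box 3 (2 ^ k)) : ℝ) *
          criticalTwoPoint 3 (Pi.single 0 ((2 ^ (k + 3) : ℕ) : ℤ)) :=
        mul_le_mul_of_nonneg_right hcard hA
    _ = ∑ _z ∈ box 3 (2 ^ (k + 1)) \ box 3 (2 ^ k),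
          criticalTwoPoint 3 (Pi.single 0 ((2 ^ (k + 3) : ℕ) : ℤ)) := by
        rw [Finset.sum_const, nsmul_eq_mul]
    _ ≤ ∑ z ∈ box 3 (2 ^ (k + 1)) \ box 3 (2 ^ k), criticalTwoPoint 3 z := Finset.sum_le_sum hpt

/-! ### Geometric comparison of `χ` at two dyadic scales -/

/-- **`χ(2^p) ≤ ε χ(2^{q+1})` for `q - p` and `q` large.** Under the hypotheses of
`exists_axis_doubling`: for every `ε > 0` there are `Q, q₁` such that `χ(2^p) ≤ ε χ(2^{q+1})` whenever
`p + Q ≤ q` and `q₁ ≤ q`. With `W_k = 8^k ⟨σ₀σ_{2^k e₁}⟩`, doubling gives `W_{k+1} ≥ (8/5) W_k`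
eventually, so by the shell bounds `χ(2^p) ≤ χ(2^{j₀}) + (2560/3) W_p`,
`χ(2^{q+1}) ≥ (56/125) W_q` and `W_p ≤ (5/8)^{q-p} W_q → 0 · W_q`, `W_q → ∞`. [cite: DuminilCopin2019, Thm. 4.8, §4.4] -/
theorem boxSum_two_pow_le {ρ : ℝ → ℝ} {Δ : ℝ} {S : CorrFamily 3}
    (hρ : ∀ δ ∈ Set.Ioc (0:ℝ) 1, 0 < ρ δ)
    (hlim : HasPointwiseScalingLimit (criticalCorr 3) ρ S) (hnd : IsNondegenerateTwoPoint S)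
    (hsc : IsScaleCovariant Δ S) {ε : ℝ} (hε : 0 < ε) :
    ∃ Q q₁ : ℕ, ∀ p q : ℕ, p + Q ≤ q → q₁ ≤ q →
      ∑ z ∈ box 3 (2 ^ p), criticalTwoPoint 3 z ≤
        ε * ∑ z ∈ box 3 (2 ^ (q + 1)), criticalTwoPoint 3 z := by
  classical
  obtain ⟨j₀, hdbl⟩ := exists_axis_doubling hρ hlim hnd hsc
  -- notation
  obtain ⟨A, hA⟩ : ∃ A : ℕ → ℝ, ∀ j, A j = criticalTwoPoint 3 (Pi.single 0 ((2 ^ j : ℕ) : ℤ)) :=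
    ⟨_, fun _ => rfl⟩
  obtain ⟨χ, hχ⟩ : ∃ χ : ℕ → ℝ, ∀ m, χ m = ∑ z ∈ box 3 m, criticalTwoPoint 3 z := ⟨_, fun _ => rfl⟩
  obtain ⟨W, hW⟩ : ∃ W : ℕ → ℝ, ∀ k, W k = 8 ^ k * A k := ⟨_, fun _ => rfl⟩
  simp only [← hχ]
  -- basic facts
  have hApos : ∀ j, 0 < A j := fun j => by rw [hA]; exact criticalTwoPoint_axis_pos (2 ^ j)
  have hWpos : ∀ k, 0 < W k := fun k => by rw [hW]; exact mul_pos (by positivity) (hApos k)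
  have hχnn : ∀ m, 0 ≤ χ m := fun m => by
    rw [hχ]; exact Finset.sum_nonneg fun z _ => criticalTwoPoint_nonneg' z
  have hχmono : ∀ m n, m ≤ n → χ m ≤ χ n := fun m n h => by
    rw [hχ, hχ]
    exact Finset.sum_le_sum_of_subset_of_nonneg (box_mono 3 h) fun z _ _ => criticalTwoPoint_nonneg' z
  have hdbl' : ∀ j, j₀ ≤ j → A j ≤ 5 * A (j + 1) := fun j hj => by rw [hA, hA]; exact hdbl j hj
  have hshell_le : ∀ k, χ (2 ^ (k + 1)) - χ (2 ^ k) ≤ 512 * W k := fun k => by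
    rw [hχ, hχ, hW, hA, ← mul_assoc]; exact shell_le k
  have hle_shell : ∀ k, 56 * 8 ^ k * A (k + 3) ≤ χ (2 ^ (k + 1)) - χ (2 ^ k) := fun k => by
    rw [hχ, hχ, hA]; exact le_shell k
  -- geometric growth of `W`
  have hWstep : ∀ k, j₀ ≤ k → 8 / 5 * W k ≤ W (k + 1) := by
    intro k hk
    rw [hW, hW, pow_succ]
    have h := hdbl' k hk
    have h8 : (0 : ℝ) ≤ 8 ^ k := by positivity
    nlinarith
  have hWiter : ∀ k, j₀ ≤ k → ∀ i, (8 / 5 : ℝ) ^ i * W k ≤ W (k + i) := by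
    intro k hk i
    induction i with
    | zero => simp
    | succ i ih =>
        calc (8 / 5 : ℝ) ^ (i + 1) * W k = 8 / 5 * ((8 / 5 : ℝ) ^ i * W k) := by ring
          _ ≤ 8 / 5 * W (k + i) := by gcongr
          _ ≤ W (k + i + 1) := hWstep (k + i) (by omega)
  have hWdecay : ∀ p q, j₀ ≤ p → p ≤ q → W p ≤ (5 / 8 : ℝ) ^ (q - p) * W q := by
    intro p q hp hpq
    have h := hWiter p hp (q - p)
    rw [show p + (q - p) = q by omega] at h
    have e : (5 / 8 : ℝ) ^ (q - p) * ((8 / 5 : ℝ) ^ (q - p) * W p) = W p := by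
      rw [← mul_assoc, ← mul_pow]; norm_num
    calc W p = (5 / 8 : ℝ) ^ (q - p) * ((8 / 5 : ℝ) ^ (q - p) * W p) := e.symm
      _ ≤ (5 / 8 : ℝ) ^ (q - p) * W q := mul_le_mul_of_nonneg_left h (by positivity)
  -- upper bound at scale `2^p`
  have hU : ∀ p, j₀ ≤ p → χ (2 ^ p) ≤ χ (2 ^ j₀) + 2560 / 3 * W p := by
    intro p hp
    induction p, hp using Nat.le_induction with
    | base => linarith [hWpos j₀]
    | succ p hp ih =>
        have h1 := hshell_le p
        have h2 := hWstep p hp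
        linarith
  -- lower bound at scale `2^(q+1)`
  have hLo : ∀ q, j₀ ≤ q → 56 / 125 * W q ≤ χ (2 ^ (q + 1)) := by
    intro q hq
    have h1 := hle_shell q
    have h2 : A q ≤ 125 * A (q + 3) := by
      have a1 := hdbl' q hq
      have a2 := hdbl' (q + 1) (by omega)
      have a3 := hdbl' (q + 2) (by omega)
      linarith
    have h3 : 56 / 125 * W q ≤ 56 * 8 ^ q * A (q + 3) := by
      rw [hW]
      have h8 : (0 : ℝ) ≤ 8 ^ q := by positivity
      nlinarith
    linarith [hχnn (2 ^ q)]
  -- the two smallness parameters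
  obtain ⟨Q, hQ⟩ := exists_pow_lt_of_lt_one
    (show (0 : ℝ) < ε * (56 / 125) / (2 * (2560 / 3)) by positivity)
    (show (5 / 8 : ℝ) < 1 by norm_num)
  obtain ⟨n₀, hn₀⟩ := pow_unbounded_of_one_lt
    (χ (2 ^ j₀) / (ε / 2 * (56 / 125) * W j₀)) (show (1 : ℝ) < 8 / 5 by norm_num)
  refine ⟨Q, j₀ + n₀, fun p q hpq hq => ?_⟩
  -- `χ(2^j₀) ≤ (ε/2)(56/125) W q`
  have hq0 : j₀ ≤ q := by omega
  have hbase : χ (2 ^ j₀) ≤ ε / 2 * (56 / 125) * W q := by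
    have h1 : (8 / 5 : ℝ) ^ n₀ * W j₀ ≤ W q := by
      have h := hWiter j₀ le_rfl (q - j₀)
      rw [show j₀ + (q - j₀) = q by omega] at h
      refine le_trans ?_ h
      exact mul_le_mul_of_nonneg_right (pow_le_pow_right₀ (by norm_num) (by omega)) (hWpos j₀).le
    have hpos : 0 < ε / 2 * (56 / 125) * W j₀ := mul_pos (by positivity) (hWpos j₀)
    have h2 : χ (2 ^ j₀) < (8 / 5 : ℝ) ^ n₀ * (ε / 2 * (56 / 125) * W j₀) := by
      rwa [div_lt_iff₀ hpos] at hn₀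
    nlinarith [hWpos j₀, hε]
  have hLoq := hLo q hq0
  by_cases hp : j₀ ≤ p
  · -- the geometric regime
    have hpq' : p ≤ q := by omega
    have h1 := hU p hp
    have h2 := hWdecay p q hp hpq'
    have h3 : (5 / 8 : ℝ) ^ (q - p) ≤ (5 / 8 : ℝ) ^ Q :=
      pow_le_pow_of_le_one (by norm_num) (by norm_num) (by omega)
    have h4 : 2560 / 3 * ((5 / 8 : ℝ) ^ Q) ≤ ε / 2 * (56 / 125) := by
      have := hQ.le
      rw [le_div_iff₀ (by positivity)] at this
      linarith
    have hWq := (hWpos q).le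
    calc χ (2 ^ p) ≤ χ (2 ^ j₀) + 2560 / 3 * W p := h1
      _ ≤ ε / 2 * (56 / 125) * W q + 2560 / 3 * ((5 / 8 : ℝ) ^ Q * W q) := by
          gcongr
          exact h2.trans (mul_le_mul_of_nonneg_right h3 hWq)
      _ = ε / 2 * (56 / 125) * W q + 2560 / 3 * (5 / 8 : ℝ) ^ Q * W q := by ring
      _ ≤ ε / 2 * (56 / 125) * W q + ε / 2 * (56 / 125) * W q := by
          gcongr
      _ = ε * (56 / 125 * W q) := by ring
      _ ≤ ε * χ (2 ^ (q + 1)) := mul_le_mul_of_nonneg_left hLoq hε.le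
  · -- below the doubling threshold: `χ(2^p) ≤ χ(2^j₀)`
    have h1 : χ (2 ^ p) ≤ χ (2 ^ j₀) :=
      hχmono _ _ (Nat.pow_le_pow_right two_pos (by omega))
    calc χ (2 ^ p) ≤ χ (2 ^ j₀) := h1
      _ ≤ ε / 2 * (56 / 125) * W q := hbase
      _ ≤ ε / 2 * χ (2 ^ (q + 1)) := by
          rw [mul_assoc]; exact mul_le_mul_of_nonneg_left hLoq (by positivity)
      _ ≤ ε * χ (2 ^ (q + 1)) := by nlinarith [hχnn (2 ^ (q + 1))]

/-- **Short distances do not dominate `χ`**: under the hypotheses of `exists_axis_doubling`, for every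
`ε > 0` there is `η ∈ (0, 1]` such that `χ(⌊ηL⌋) ≤ ε χ(L/2)` for all large `L`
(`boxSum_two_pow_le` between the dyadic scales `2^{⌊log₂ ⌊ηL⌋⌋+1} ≥ ⌊ηL⌋` and `2^{⌊log₂ (L/2)⌋} ≤ L/2`).
[cite: DuminilCopin2019, Thm. 4.8, §4.4] -/
theorem exists_eta_boxSum_floor_le {ρ : ℝ → ℝ} {Δ : ℝ} {S : CorrFamily 3}
    (hρ : ∀ δ ∈ Set.Ioc (0:ℝ) 1, 0 < ρ δ)
    (hlim : HasPointwiseScalingLimit (criticalCorr 3) ρ S) (hnd : IsNondegenerateTwoPoint S)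
    (hsc : IsScaleCovariant Δ S) {ε : ℝ} (hε : 0 < ε) :
    ∃ η : ℝ, 0 < η ∧ η ≤ 1 ∧ ∀ᶠ L : ℕ in atTop,
      ∑ z ∈ box 3 ⌊η * L⌋₊, criticalTwoPoint 3 z ≤
        ε * ∑ z ∈ box 3 (L / 2), criticalTwoPoint 3 z := by
  classical
  obtain ⟨Q, q₁, hQ⟩ := boxSum_two_pow_le hρ hlim hnd hsc hε
  have hχmono : ∀ m n, m ≤ n →
      ∑ z ∈ box 3 m, criticalTwoPoint 3 z ≤ ∑ z ∈ box 3 n, criticalTwoPoint 3 z := fun m n h =>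
    Finset.sum_le_sum_of_subset_of_nonneg (box_mono 3 h) fun z _ _ => criticalTwoPoint_nonneg' z
  refine ⟨1 / 2 ^ (Q + 6), by positivity, ?_, ?_⟩
  · rw [div_le_one (by positivity)]
    exact one_le_pow₀ (by norm_num)
  filter_upwards [eventually_ge_atTop (2 ^ (Q + 3) + 2 ^ (q₁ + 3) + 2)] with L hL
  have hQ3 : 1 ≤ 2 ^ (Q + 3) := Nat.one_le_two_pow
  have hq3 : 1 ≤ 2 ^ (q₁ + 3) := Nat.one_le_two_pow
  have hQ2 : 1 ≤ 2 ^ (Q + 2) := Nat.one_le_two_pow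
  have hq1' : 1 ≤ 2 ^ (q₁ + 1) := Nat.one_le_two_pow
  set n : ℕ := ⌊1 / 2 ^ (Q + 6) * (L : ℝ)⌋₊ with hn
  set m : ℕ := L / 2 with hm
  have hm2 : L ≤ 2 * m + 1 := by omega
  have hm0 : m ≠ 0 := by omega
  -- `n · 2^(Q+6) ≤ L`
  have hnL : n * 2 ^ (Q + 6) ≤ L := by
    have h1 : (n : ℝ) ≤ 1 / 2 ^ (Q + 6) * (L : ℝ) := Nat.floor_le (by positivity)
    have h2 : (n : ℝ) * 2 ^ (Q + 6) ≤ L := by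
      rw [one_div, le_inv_mul_iff₀ (by positivity)] at h1
      linarith
    exact_mod_cast h2
  -- the dyadic scales `p = log₂ n + 1`, `lm = log₂ m`
  set p : ℕ := Nat.log 2 n + 1 with hp
  have hnp : n < 2 ^ p := Nat.lt_pow_succ_log_self one_lt_two n
  have hkey : 2 ^ (Nat.log 2 n + Q + 2) ≤ m := by
    rcases Nat.eq_zero_or_pos n with hn0 | hn0
    · rw [hn0, Nat.log_zero_right, zero_add]
      have : 2 ^ (Q + 3) = 2 * 2 ^ (Q + 2) := by rw [pow_succ]; ring
      omega
    · have h1 : 2 ^ Nat.log 2 n ≤ n := Nat.pow_log_le_self 2 hn0.ne'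
      have h2 : 2 ^ (Nat.log 2 n + Q + 2) ≤ n * 2 ^ (Q + 2) := by
        rw [show Nat.log 2 n + Q + 2 = Nat.log 2 n + (Q + 2) by omega, pow_add]
        exact Nat.mul_le_mul_right _ h1
      have h3 : 2 ^ (Q + 6) = 2 ^ (Q + 2) * 16 := by
        rw [show Q + 6 = Q + 2 + 4 by omega, pow_add]; norm_num
      rw [h3, ← mul_assoc] at hnL
      omega
  have hlm : Nat.log 2 n + Q + 2 ≤ Nat.log 2 m := (Nat.le_log_iff_pow_le one_lt_two hm0).2 hkey
  have hq₁ : q₁ + 1 ≤ Nat.log 2 m := by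
    refine (Nat.le_log_iff_pow_le one_lt_two hm0).2 ?_
    have : 2 ^ (q₁ + 3) = 4 * 2 ^ (q₁ + 1) := by rw [pow_add]; ring
    omega
  set lm : ℕ := Nat.log 2 m with hlmdef
  obtain ⟨q, hq⟩ : ∃ q, lm = q + 1 := ⟨lm - 1, by omega⟩
  have hmain := hQ p q (by omega) (by omega)
  rw [← hq] at hmain
  have h2m : 2 ^ lm ≤ m := Nat.pow_log_le_self 2 hm0
  calc ∑ z ∈ box 3 n, criticalTwoPoint 3 z ≤ ∑ z ∈ box 3 (2 ^ p), criticalTwoPoint 3 z :=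
        hχmono _ _ hnp.le
    _ ≤ ε * ∑ z ∈ box 3 (2 ^ lm), criticalTwoPoint 3 z := hmain
    _ ≤ ε * ∑ z ∈ box 3 m, criticalTwoPoint 3 z :=
        mul_le_mul_of_nonneg_left (hχmono _ _ h2m) hε.le

end Summit.CriticalPhenomena.Ising3DConformalLimit.LeeYangGapGaussianLimitKillsBlockCoupling

end
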